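import Summits.AtomisticToContinuum.FouriersLaw.Theses.ContactStieltjesMeasure
import Summits.AtomisticToContinuum.FouriersLaw.Theorems.ContactStieltjesMeasureStieltjesRepresentationStubStieltjesOfPencil

/-!
# `StieltjesRepresentation` (K2, crux stmt-AtomisticToContinuum-15248): its refutable consequences (kill criteria)

Negative-lane lemma of the cdisprove seat (route ContactStieltjesMeasure, sub-problem FouriersLaw).  The crux K2
(`…Theses.ContactStieltjesMeasure.StieltjesRepresentation`) is taken as a HYPOTHESIS; the conclusion is the precise
finite-`N` kill test on the open range `lam, β > 0`: for `0 < γ₁ ≤ γ₂` the responses `D(γ₁), D(γ₂)` (limits of the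
response quotient along any steady families; they exist by `finiteResponseOfUnique_holds`, weak-NESS uniqueness is the
tree's `nessUnique_proof`) satisfy `0 ≤ D(γ₂)` and `D(γ₂)/γ₂ ≤ D(γ₁)/γ₁` — `G_N(γ)/γ` is non-negative and
non-increasing in the friction.  One certified violation at one `N` and two frictions refutes K2 by modus tollens.
(Pointwise monotonicity of the layer-cake weight `2t/(γ²+t²)²` in `γ`; its integrability on `(0,∞)` is the tree's
`CayleyPencil.Stieltjes.integrableOn_weight_Ioi`; no Stieltjes theory.)  Nothing here asserts a
Theses statement; no item is closed (`--supports stmt-AtomisticToContinuum-15248`).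
-/

noncomputable section

namespace Summit.AtomisticToContinuum.FouriersLaw.Theorems.StieltjesRepresentation.Negative

open MeasureTheory Filter Set
open scoped Topology
open Literature.MathematicalPhysics.KineticTheory.HeatConduction

/-- **Kill criteria made formal.**  IF K2 holds then on the open range `lam, β > 0`, for every `T > 0`, `N ≥ 2` and two
frictions `0 < γ₁ ≤ γ₂`, the finite-`N` responses `D(γ₁), D(γ₂)` — the limits of the response quotient along ANY
steady families of the two chains (they exist: `finiteResponseOfUnique_holds`; uniqueness of weak steady states is the
tree's `nessUnique_proof`) — satisfy `0 ≤ D(γ₂)` and `D(γ₂)/γ₂ ≤ D(γ₁)/γ₁`: the conductance per unit friction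
`G_N(γ)/γ` is non-negative and NON-INCREASING in `γ` (pointwise in the layer-cake weight; no Stieltjes theory needed).
One certified violation at any finite `N` (two frictions suffice) refutes K2 by modus tollens — this is the precise
form of the route's "oddness/CM of `G_N(γ)/γ`" kill test at orders 0 and 1. [folklore] -/
theorem killCriterion
    (hK2 : Summit.AtomisticToContinuum.FouriersLaw.Theses.ContactStieltjesMeasure.StieltjesRepresentation)
    {ω₂ lam β : ℝ} (hω : 0 < ω₂) (hl : 0 < lam) (hβ : 0 < β) {T : ℝ} (hT : 0 < T) {N : ℕ} (hN : 2 ≤ N)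
    {γ₁ γ₂ : ℝ} (hγ₁ : 0 < γ₁) (h12 : γ₁ ≤ γ₂)
    (μ₁ μ₂ : (N' : ℕ) → ℝ → ℝ → Measure (PhaseSpace N'))
    (hμ₁ : ∀ (N' : ℕ) (T_L T_R : ℝ), 0 < T_L → 0 < T_R →
      (pinnedChain ω₂ lam β γ₁).IsSteadyState N' T_L T_R (μ₁ N' T_L T_R))
    (hμ₂ : ∀ (N' : ℕ) (T_L T_R : ℝ), 0 < T_L → 0 < T_R →
      (pinnedChain ω₂ lam β γ₂).IsSteadyState N' T_L T_R (μ₂ N' T_L T_R))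
    {D₁ D₂ : ℝ}
    (hD₁ : Tendsto (fun δ : ℝ => (pinnedChain ω₂ lam β γ₁).totalCurrent (μ₁ N (T + δ / 2) (T - δ / 2)) / δ)
      (𝓝[≠] 0) (𝓝 D₁))
    (hD₂ : Tendsto (fun δ : ℝ => (pinnedChain ω₂ lam β γ₂).totalCurrent (μ₂ N (T + δ / 2) (T - δ / 2)) / δ)
      (𝓝[≠] 0) (𝓝 D₂)) :
    0 ≤ D₂ ∧ D₂ / γ₂ ≤ D₁ / γ₁ := by
  have hγ₂ : 0 < γ₂ := lt_of_lt_of_le hγ₁ h12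
  obtain ⟨Φ, hΦ⟩ := hK2 ω₂ lam β hω hl.le hβ.le T hT
  obtain ⟨hmono, hzero, ⟨m, hm⟩, hlim⟩ := hΦ N hN
  have hU := fun (γ : ℝ) (hγ : 0 < γ) =>
    Summit.AtomisticToContinuum.FouriersLaw.Theorems.nessUnique_proof ω₂ lam β γ hω hl hβ hγ
  set I : ℝ → ℝ := fun γ => ∫ t in Set.Ioi (0 : ℝ), Φ N t * (2 * t / (γ ^ 2 + t ^ 2) ^ 2) with hI
  have hD₁eq : D₁ = ((N : ℝ) - 1) * γ₁ * I γ₁ :=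
    tendsto_nhds_unique hD₁ (hlim γ₁ hγ₁ (hU γ₁ hγ₁) μ₁ hμ₁)
  have hD₂eq : D₂ = ((N : ℝ) - 1) * γ₂ * I γ₂ :=
    tendsto_nhds_unique hD₂ (hlim γ₂ hγ₂ (hU γ₂ hγ₂) μ₂ hμ₂)
  -- `Φ_N ≥ 0` everywhere (`Φ_N = 0` on `(-∞,0]`, monotone) and `Φ_N ≤ m`
  have hΦnn : ∀ t : ℝ, 0 ≤ Φ N t := by
    intro t
    rcases le_or_gt t 0 with ht | ht
    · rw [hzero t ht]
    · simpa [hzero 0 le_rfl] using hmono ht.le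
  have hw_le : ∀ t : ℝ, 0 < t → 2 * t / (γ₂ ^ 2 + t ^ 2) ^ 2 ≤ 2 * t / (γ₁ ^ 2 + t ^ 2) ^ 2 := by
    intro t ht
    apply div_le_div_of_nonneg_left (by linarith) (by positivity)
    have : γ₁ ^ 2 ≤ γ₂ ^ 2 := pow_le_pow_left₀ hγ₁.le h12 2
    nlinarith [sq_nonneg t]
  have hw_nn : ∀ (γ t : ℝ), 0 < t → 0 ≤ 2 * t / (γ ^ 2 + t ^ 2) ^ 2 := fun γ t ht =>
    div_nonneg (by linarith) (by positivity)
  -- integrability of the larger integrand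
  have hint₁ : Integrable (fun t : ℝ => Φ N t * (2 * t / (γ₁ ^ 2 + t ^ 2) ^ 2)) (volume.restrict (Set.Ioi 0)) := by
    refine Integrable.bdd_mul (c := max m 0)
      (Summit.AtomisticToContinuum.FouriersLaw.Theorems.ContactStieltjesMeasure.CayleyPencil.Stieltjes.integrableOn_weight_Ioi
        hγ₁) hmono.measurable.aestronglyMeasurable
      (Filter.Eventually.of_forall fun t => ?_)
    rw [Real.norm_eq_abs, abs_of_nonneg (hΦnn t)]
    exact le_trans (hm t) (le_max_left _ _)
  have hI_le : I γ₂ ≤ I γ₁ := by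
    refine integral_mono_of_nonneg ?_ hint₁ ?_
    · refine (ae_restrict_iff' measurableSet_Ioi).2 (Filter.Eventually.of_forall fun t ht => ?_)
      exact mul_nonneg (hΦnn t) (hw_nn γ₂ t ht)
    · refine (ae_restrict_iff' measurableSet_Ioi).2 (Filter.Eventually.of_forall fun t ht => ?_)
      exact mul_le_mul_of_nonneg_left (hw_le t ht) (hΦnn t)
  have hI_nn : 0 ≤ I γ₂ :=
    setIntegral_nonneg measurableSet_Ioi fun t ht => mul_nonneg (hΦnn t) (hw_nn γ₂ t ht)
  have hN1 : 0 ≤ (N : ℝ) - 1 := by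
    have : (2 : ℝ) ≤ N := by exact_mod_cast hN
    linarith
  refine ⟨?_, ?_⟩
  · rw [hD₂eq]
    exact mul_nonneg (mul_nonneg hN1 hγ₂.le) hI_nn
  · have e₁ : D₁ / γ₁ = ((N : ℝ) - 1) * I γ₁ := by
      rw [hD₁eq]; field_simp
    have e₂ : D₂ / γ₂ = ((N : ℝ) - 1) * I γ₂ := by
      rw [hD₂eq]; field_simp
    rw [e₁, e₂]
    exact mul_le_mul_of_nonneg_left hI_le hN1

end Summit.AtomisticToContinuum.FouriersLaw.Theorems.StieltjesRepresentation.Negative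

end
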